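import Summits.QuantumFields.BalabanUV.Beta.GAN24.BiStencilZeroMode

/-!
# `BalabanUV.Beta.GAN24.CovariantFamilyCellPairing` — binder row G-an2-4 ∕ (CONV-C), W-slot CT-W, conservation law (C)∕(C)sym, step (P5)(II-c) of this lineage's note
# `HOME/b2b-balaban-gan24-formalise-leaf-04/g65/CSYM-LEVEL0-KERNEL-BLUEPRINT.md`: **CELL REGROUPING OF A JOINTLY COVARIANT FAMILY OF LOCALISED SOURCES AGAINST A
# BLOCK-PERIODIC FIELD — `Σ_{u ∈ cell} Σ'_y j_u(y)·A(y) = Σ_{y ∈ cell} (Σ'_u j_u)(y)·A(y)`** (generic `d`, every `N ≥ 1`)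

NOT IN PRINT; OUR BOOKKEEPING ([folklore] lattice-sum regrouping BY NAME over leaf-02's `GAN24.BiStencilZeroMode.tsum_eq_sum_box_tsum ∕ tsum_mul_periodic`; G-an2-4
formalisation swarm, leaf prover `b2b-balaban-gan24-formalise-leaf-04`, gen 65).  HONEST FRAMING (cell contract, verbatim): «discharging `BetaPertH` makes Bałaban's UV
stability UNCONDITIONAL — a real constructive-QFT result; it is NOT the continuum limit and NOT the Clay problem.»  HONEST DEPENDENCY (verbatim): «continuum YM on T⁴ ⇐
BetaPertH ∧ nine spine estimates (0/9 proved); BetaPertH ⇐ (D1) ∧ (D4) ∧ CAP+tail; G-an2-4 gates asym, D1 and NE2/3/4.»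

WHY (blueprint §1 (II)): in the zero mode `zmode N` of the dressed one-step source the FIRST background bond runs over ONE cell and the second over the lattice
(`BiStencilZeroMode.zmode`); after the two-face read-out (`GAN24.DressedStepFaceCharges.hasSum_mmRead_K3OfK_dressedStep`) the cubic-E × cubic-E exchange word is
`Σ_{u ∈ cell} ⟨j_u, X·J′⟩` with `j_u` the (dressed) half-vertex current sourced by the background bond `u` — a jointly covariant, localised family whose lattice
resummation `Σ'_u j_u = J` is the block-periodic EDGE CURRENT — and `X·J′` block-periodic.  THIS FILE turns that into the CELL pairing `⟨J, X·J′⟩_cell` of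
`GAN24.PeriodicKKTExchangePairing.card_mul_pairing_eq ∕ _plaq`.

WHAT ([folklore]; 0 `def`, 0 cited facts, 0 `def … : Prop`, 0 sorry): **`sum_box_tsum_mul_periodic`** (scalar: `j (u + N•t) (y + N•t) = j u y`, `A` periodic, `u ↦ j u y` summable,
`y ↦ j u y·A y` summable ⇒ `Σ_{r ∈ box} Σ'_y j (toSite r) y·A y = Σ_{r ∈ box} (Σ'_u j u (toSite r))·A (toSite r)`), **`sum_box_tsum_sum_mul_periodic`** (1-form version, summed
over the direction).  Asserts NO value of Bałaban's tables; discharges NOTHING of (C)sym ∕ (Q-D) ∕ (Q-D-rate) ∕ «T2Shape» ∕ «T2Drift» ∕ (hW, hWall); NEVER «G-an2-4 closed» as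
(CONV-C); NOT D1, NOT `BetaPertH`, NOT continuum, NOT Clay.  2026-08-22; no existing file touched.
-/

noncomputable section

open Finset
open scoped BigOperators
open Literature.MathematicalPhysics.QuantumFieldTheory
open Literature.MathematicalPhysics.QuantumFieldTheory.Balaban1983to89.Beta
open AffineAveraging (Form1 Site box toSite)
open Summit.QuantumFields.BalabanUV.Beta.GAN24.BiStencilZeroMode (tsum_eq_sum_box_tsum tsum_mul_periodic)

namespace Summit.QuantumFields.BalabanUV.Beta.GAN24.CovariantFamilyCellPairing

variable {d N : ℕ} [NeZero N]

/-- [folklore] **CELL REGROUPING OF A COVARIANT FAMILY AGAINST A PERIODIC FIELD** (scalar form): for a jointly `N`-covariant family of lattice functions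
`j u` (`j (u + N•t) (y + N•t) = j u y`), summable in the family index at every site and with summable pairings, and an `N`-periodic `A`,
`Σ_{u ∈ cell} Σ'_y j u y·A y = Σ_{y ∈ cell} (Σ'_u j u y)·A y` — the first-slot cell sum of the zero mode pairs the RESUMMED source with `A` over ONE cell. -/
theorem sum_box_tsum_mul_periodic {j : Site (d + 1) → Site (d + 1) → ℝ} {A : Site (d + 1) → ℝ}
    (hcov : ∀ u y t, j (u + (N : ℤ) • t) (y + (N : ℤ) • t) = j u y) (hA : ∀ y t, A (y + (N : ℤ) • t) = A y)
    (hju : ∀ y, Summable fun u => j u y) (hjy : ∀ u, Summable fun y => j u y * A y) :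
    ∑ r ∈ box (d + 1) N, ∑' y, j (toSite r) y * A y = ∑ r ∈ box (d + 1) N, (∑' u, j u (toSite r)) * A (toSite r) := by
  -- regroup the target `y` over cells, then use covariance to move the block index onto the source
  have h1 : ∀ r : Fin (d + 1) → ℕ, ∑' y, j (toSite r) y * A y =
      ∑ r' ∈ box (d + 1) N, A (toSite r') * ∑' t : Site (d + 1), j (toSite r + (N : ℤ) • t) (toSite r') := by
    intro r
    rw [tsum_mul_periodic (N := N) hA (hjy (toSite r))]
    refine Finset.sum_congr rfl fun r' _ => ?_
    congr 1
    rw [← (Equiv.neg (Site (d + 1))).tsum_eq (fun t : Site (d + 1) => j (toSite r + (N : ℤ) • t) (toSite r'))]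
    refine tsum_congr fun t => ?_
    have e := hcov (toSite r + (N : ℤ) • (Equiv.neg (Site (d + 1)) t)) (toSite r') t
    rw [show toSite r + (N : ℤ) • (Equiv.neg (Site (d + 1)) t) + (N : ℤ) • t = toSite r by simp [smul_neg],
      add_comm (toSite r') ((N : ℤ) • t)] at e
    exact e
  simp_rw [h1]
  rw [Finset.sum_comm]
  refine Finset.sum_congr rfl fun r' _ => ?_
  rw [← Finset.mul_sum, mul_comm]
  congr 1
  rw [tsum_eq_sum_box_tsum (N := N) (hju (toSite r'))]
  refine Finset.sum_congr rfl fun r _ => tsum_congr fun t => ?_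
  rw [add_comm]

/-- [folklore] **CELL REGROUPING, 1-FORM VERSION**: for a jointly covariant family of localised 1-forms `j u` and a block-periodic 1-form `A`,
`Σ_{u ∈ cell} Σ'_y Σ_l j u l y·A l y = Σ_{r ∈ box} Σ_l (Σ'_u j u l (toSite r))·A l (toSite r)` — the currency of `PeriodicKKTExchangePairing.card_mul_pairing_eq`'s
left-hand side (the resummed current `J l x := Σ'_u j u l x`). -/
theorem sum_box_tsum_sum_mul_periodic {j : Site (d + 1) → Form1 (d + 1) ℝ} {A : Form1 (d + 1) ℝ}
    (hcov : ∀ u l y t, j (u + (N : ℤ) • t) l (y + (N : ℤ) • t) = j u l y) (hA : ∀ l y t, A l (y + (N : ℤ) • t) = A l y)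
    (hju : ∀ l y, Summable fun u => j u l y) (hjy : ∀ u l, Summable fun y => j u l y * A l y) :
    ∑ r ∈ box (d + 1) N, ∑' y, ∑ l, j (toSite r) l y * A l y =
      ∑ r ∈ box (d + 1) N, ∑ l, (∑' u, j u l (toSite r)) * A l (toSite r) := by
  have e : ∀ r : Fin (d + 1) → ℕ, ∑' y, ∑ l, j (toSite r) l y * A l y = ∑ l, ∑' y, j (toSite r) l y * A l y := fun r =>
    Summable.tsum_finsetSum fun l _ => hjy (toSite r) l
  simp_rw [e]
  rw [Finset.sum_comm]
  conv_rhs => rw [Finset.sum_comm]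
  refine Finset.sum_congr rfl fun l _ => ?_
  exact sum_box_tsum_mul_periodic (N := N) (j := fun u y => j u l y) (A := A l) (fun u y t => hcov u l y t) (fun y t => hA l y t)
    (fun y => hju l y) (fun u => hjy u l)

end Summit.QuantumFields.BalabanUV.Beta.GAN24.CovariantFamilyCellPairing

end
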